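import Summits.BirchSwinnertonDyer.BirchSwinnertonDyer.Theorems.PrintCFramBottomClassIndexLawFiveLeOffLocusDictionary
import HarnessLib

/-!
# Crux `PrintCFram.BottomClassIndexLawFiveLe` (stmt-BirchSwinnertonDyer-20372), line `eisenstein-resource-bdp-line` (registry v15):
# THE OFF-LOCUS RESIDUE BY NAME — «no character data» ⟺ Kriz–Li's (4) fails at every Heegner field; the CLASS-FACTOR SPLIT
# (cell `bsd-print-cfram`, width seat `bsd-line-cfram-p1-w3` g7; THEOREMS ONLY, `--supports` 20372; BSD is not proved by any of this)

HONEST FRAMING. Nothing here is a statement about BSD; the crux C2 is CLASS-WIDE and stays OPEN; no stub is closed. Sequel of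
`…OffLocusDictionary` ((1a) the Kriz–Li triple exists class-wide modulo (4); (1b) (4) is rigid). Registry v15 (LEAD g10) carries the
two research stubs with the hypothesis «NO CHARACTER DATA» (the character-data side of w6 g2's
`KrizLiLValueFree.exists_krizLiDatum_iff_exists_characterData`, verbatim). This file rewrites that hypothesis as a statement about
BERNOULLI NUMBERS ONLY:

* `not_exists_characterData_iff_forall_bernoulliFour_fails` — «no character data» ⟺ for every imaginary quadratic `K''` Heegner for
  `N_W` with `d` odd `< −4` and EVERY `(f, ψ, ω, ε_{K''})` with `ω` Teichmüller, `hss`, `IsKroneckerCharacterOf` (no primitivity /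
  (1) / (3) asked): `‖B_{1,ψ₀⁻¹ε_K}·B_{1,ψ₀ω⁻¹}‖_p ≤ p⁻¹`;
* `not_exists_characterData_iff_forall_exists_bernoulliFour_fails` — ⟺ at every such `K''` SOME triple with the full v15 binder block
  fails (4);
* `not_exists_characterData_iff_classFactor_or_forall` — for ANY odd datum `(f, ψ, ω)` of `W` with `hss` (the class character of
  `OffLocusDictionary.exists_krizLiTriple_odd_of_cmRamified` is one; on the rank-one window `ψ` is always odd, w2 g4 census):
  «no character data» ⟺ **`‖B_{1,ψ⁻¹}‖_p ≤ p⁻¹`** (the CLASS factor — w2 g4's p634386 reading; the two level-`1` cells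
  `17424bl1@11`, `305809c1@7`) **∨ for every Heegner `K''` (`d` odd `< −4`) and its `ε_{K''}`: `‖B_{1,(ψε_{K''}ω⁻¹)~}‖_p ≤ p⁻¹`**
  (both factors are `p`-integral at a Heegner field: w3 g4 `BernoulliUnits.norm_bernoulliPair_le_one_of_hss`, `p ∤ d_{K''}` since
  `p ∣ N_W` splits).

beyond-print theorem: NO (dictionary). BSD is not proved by any of this; no summit statement is proved by this seat.

References: [KrizLi2019] Thm. 1.20 (pp. 7–8), Rem. 1.21 (p. 8), §7.1 (p. 43), Cor. 8.4; [GrossLMS1991] §1 (p. 235, Heegner hypothesis).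
-/

set_option autoImplicit false
-- summit-side namespace `Summit.BirchSwinnertonDyer.BirchSwinnertonDyer.…` (single-conjunct summit, D-0017 layout)
set_option linter.dupNamespace false

noncomputable section

open scoped Classical
open NumberField DirichletCharacter WeierstrassCurve
open Literature.NumberTheory.EllipticCurves Literature.NumberTheory.EllipticCurves.KrizLi2019
  Literature.NumberTheory.EllipticCurves.Rank1Residual

namespace Summit.BirchSwinnertonDyer.BirchSwinnertonDyer.Theorems.PrintCFram.OffLocusResidue

open Summit.BirchSwinnertonDyer.BirchSwinnertonDyer.Theorems.PrintCFram
open Summit.BirchSwinnertonDyer.BirchSwinnertonDyer.Theorems.PrintCFram.OffLocusDictionary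

/-! ## §5 THE OFF-LOCUS RESIDUE BY NAME: «no character data» ⟺ (4) fails — Bernoulli numbers only -/

section Residue

variable (W : WeierstrassCurve ℚ) [W.IsElliptic] [W.IsGloballyMinimal] (p : ℕ) [Fact p.Prime]

/-- **«NO CHARACTER DATA» ⟺ (4) FAILS FOR EVERY ADMISSIBLE TRIPLE AT EVERY HEEGNER FIELD.** For `W/ℚ` (CM, `CMRamified W p`,
`5 ≤ p`): the negated existential of registry v15's off-locus stubs — verbatim the character-data side of w6 g2's
`KrizLiLValueFree.exists_krizLiDatum_iff_exists_characterData` — holds iff for every imaginary quadratic `K''`, Heegner for `N_W`,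
with `d_{K''}` odd `< −4`, and EVERY `(f, ψ, ω, ε_{K''})` with `ω` Teichmüller, the trace form `hss` and
`IsKroneckerCharacterOf K'' ε_{K''}` (no primitivity, no (1), no (3) asked): `‖B_{1,ψ₀⁻¹ε_K}·B_{1,ψ₀ω⁻¹}‖_p ≤ p⁻¹`. (`→`: if some
such triple satisfied (4), the class triple of `exists_krizLiTriple_of_cmRamified` at `K''` would satisfy it too by rigidity
`bernoulliFour_iff_of_hss`, giving character data; `←`: character data contain such a triple with (4).)
[cite: KrizLi2019, Thm. 1.20 (pp. 7–8), Rem. 1.21 (p. 8), §7.1 (p. 43)] -/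
theorem not_exists_characterData_iff_forall_bernoulliFour_fails (hCM : W.HasCM) (hram : CMRamified W p) (h5 : 5 ≤ p) :
    (¬ ∃ (K : Type) (_ : Field K) (_ : NumberField K)
      (f : ℕ) (_ : NeZero f) (ψ : DirichletCharacter ℚ_[p] f) (ω : DirichletCharacter ℚ_[p] p)
      (εK : DirichletCharacter ℚ_[p] (NumberField.discr K).natAbs),
      IsImaginaryQuadratic K ∧ SatisfiesHeegnerHypothesis (W.conductorNorm ℤ) K ∧ Odd (NumberField.discr K) ∧
      NumberField.discr K < -4 ∧ ψ.IsPrimitive ∧ KrizLi2019.IsTeichmullerCharacter ω ∧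
      (∀ ℓ : ℕ, ℓ.Prime → ¬ (ℓ ∣ p * W.conductorNorm ℤ) →
        ‖((W.LFunction ℓ : ℤ) : ℚ_[p]) - (ψ (ℓ : ZMod f) + ψ⁻¹ (ℓ : ZMod f) * ω (ℓ : ZMod p))‖ < 1) ∧
      ψ (p : ZMod f) ≠ 1 ∧ KrizLi2019.primVal (KrizLi2019.invMulOmega ψ ω) p ≠ 1 ∧
      (∀ ℓ : ℕ, (hℓ : ℓ.Prime) → ℓ ≠ p →
        (haveI := Fact.mk hℓ; ¬ W.HasGoodReductionAtPrime ℓ ∧ ¬ W.HasMultiplicativeReductionAtPrime ℓ) →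
        ψ (ℓ : ZMod f) ≠ 1 ∧ KrizLi2019.primVal (KrizLi2019.invMulOmega ψ ω) ℓ ≠ 1) ∧
      KrizLi2019.IsKroneckerCharacterOf K εK ∧
      ¬ (‖KrizLi2019.bernoulliOnePrim (KrizLi2019.bernoulliCharOne ψ εK) *
          KrizLi2019.bernoulliOnePrim (KrizLi2019.bernoulliCharTwo ψ εK ω)‖ ≤ (p : ℝ)⁻¹)) ↔
    ∀ (K : Type) [Field K] [NumberField K], IsImaginaryQuadratic K → SatisfiesHeegnerHypothesis (W.conductorNorm ℤ) K →
      Odd (NumberField.discr K) → NumberField.discr K < -4 →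
      ∀ (f : ℕ) [NeZero f] (ψ : DirichletCharacter ℚ_[p] f) (ω : DirichletCharacter ℚ_[p] p)
        (εK : DirichletCharacter ℚ_[p] (NumberField.discr K).natAbs),
        KrizLi2019.IsTeichmullerCharacter ω →
        (∀ ℓ : ℕ, ℓ.Prime → ¬ (ℓ ∣ p * W.conductorNorm ℤ) →
          ‖((W.LFunction ℓ : ℤ) : ℚ_[p]) - (ψ (ℓ : ZMod f) + ψ⁻¹ (ℓ : ZMod f) * ω (ℓ : ZMod p))‖ < 1) →
        KrizLi2019.IsKroneckerCharacterOf K εK →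
        ‖KrizLi2019.bernoulliOnePrim (KrizLi2019.bernoulliCharOne ψ εK) *
            KrizLi2019.bernoulliOnePrim (KrizLi2019.bernoulliCharTwo ψ εK ω)‖ ≤ (p : ℝ)⁻¹ := by
  constructor
  · intro hne K _ _ hK hH hodd hd4 f _ ψ ω εK hω hss hεK
    by_contra h4
    apply hne
    obtain ⟨f₀, hf₀, ψ₀, ω₀, εK₀, hprim, hω₀, hss₀, h1, h1', h3, hεK₀⟩ :=
      exists_krizLiTriple_of_cmRamified W p hCM hram h5 K hK
    refine ⟨K, inferInstance, inferInstance, f₀, hf₀, ψ₀, ω₀, εK₀, hK, hH, hodd, hd4, hprim, hω₀, hss₀, h1, h1', h3, hεK₀,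
      ?_⟩
    rw [bernoulliFour_iff_of_hss W h5 K ψ₀ ψ ω₀ ω εK₀ εK hω₀ hω hss₀ hss hεK₀ hεK]
    exact h4
  · rintro hall ⟨K, iF, iNF, f, iNf, ψ, ω, εK, hK, hH, hodd, hd4, -, hω, hss, -, -, -, hεK, h4⟩
    exact h4 (hall K hK hH hodd hd4 f ψ ω εK hω hss hεK)

/-- **«NO CHARACTER DATA» ⟺ AT EVERY HEEGNER FIELD SOME ADMISSIBLE TRIPLE FAILS (4)** — the existential form (the class triple
of `exists_krizLiTriple_of_cmRamified` is a witness; conversely one failing triple kills every other by rigidity). The witness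
carries the full binder block `hψ hω hss h1 h1' h3 hεK` of the v15 character data.
[cite: KrizLi2019, Thm. 1.20 (pp. 7–8), Rem. 1.21 (p. 8), §7.1 (p. 43)] -/
theorem not_exists_characterData_iff_forall_exists_bernoulliFour_fails (hCM : W.HasCM) (hram : CMRamified W p)
    (h5 : 5 ≤ p) :
    (¬ ∃ (K : Type) (_ : Field K) (_ : NumberField K)
      (f : ℕ) (_ : NeZero f) (ψ : DirichletCharacter ℚ_[p] f) (ω : DirichletCharacter ℚ_[p] p)
      (εK : DirichletCharacter ℚ_[p] (NumberField.discr K).natAbs),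
      IsImaginaryQuadratic K ∧ SatisfiesHeegnerHypothesis (W.conductorNorm ℤ) K ∧ Odd (NumberField.discr K) ∧
      NumberField.discr K < -4 ∧ ψ.IsPrimitive ∧ KrizLi2019.IsTeichmullerCharacter ω ∧
      (∀ ℓ : ℕ, ℓ.Prime → ¬ (ℓ ∣ p * W.conductorNorm ℤ) →
        ‖((W.LFunction ℓ : ℤ) : ℚ_[p]) - (ψ (ℓ : ZMod f) + ψ⁻¹ (ℓ : ZMod f) * ω (ℓ : ZMod p))‖ < 1) ∧
      ψ (p : ZMod f) ≠ 1 ∧ KrizLi2019.primVal (KrizLi2019.invMulOmega ψ ω) p ≠ 1 ∧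
      (∀ ℓ : ℕ, (hℓ : ℓ.Prime) → ℓ ≠ p →
        (haveI := Fact.mk hℓ; ¬ W.HasGoodReductionAtPrime ℓ ∧ ¬ W.HasMultiplicativeReductionAtPrime ℓ) →
        ψ (ℓ : ZMod f) ≠ 1 ∧ KrizLi2019.primVal (KrizLi2019.invMulOmega ψ ω) ℓ ≠ 1) ∧
      KrizLi2019.IsKroneckerCharacterOf K εK ∧
      ¬ (‖KrizLi2019.bernoulliOnePrim (KrizLi2019.bernoulliCharOne ψ εK) *
          KrizLi2019.bernoulliOnePrim (KrizLi2019.bernoulliCharTwo ψ εK ω)‖ ≤ (p : ℝ)⁻¹)) ↔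
    ∀ (K : Type) [Field K] [NumberField K], IsImaginaryQuadratic K → SatisfiesHeegnerHypothesis (W.conductorNorm ℤ) K →
      Odd (NumberField.discr K) → NumberField.discr K < -4 →
      ∃ (f : ℕ) (_ : NeZero f) (ψ : DirichletCharacter ℚ_[p] f) (ω : DirichletCharacter ℚ_[p] p)
        (εK : DirichletCharacter ℚ_[p] (NumberField.discr K).natAbs),
        ψ.IsPrimitive ∧ KrizLi2019.IsTeichmullerCharacter ω ∧
        (∀ ℓ : ℕ, ℓ.Prime → ¬ (ℓ ∣ p * W.conductorNorm ℤ) →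
          ‖((W.LFunction ℓ : ℤ) : ℚ_[p]) - (ψ (ℓ : ZMod f) + ψ⁻¹ (ℓ : ZMod f) * ω (ℓ : ZMod p))‖ < 1) ∧
        ψ (p : ZMod f) ≠ 1 ∧ KrizLi2019.primVal (KrizLi2019.invMulOmega ψ ω) p ≠ 1 ∧
        (∀ ℓ : ℕ, (hℓ : ℓ.Prime) → ℓ ≠ p →
          (haveI := Fact.mk hℓ; ¬ W.HasGoodReductionAtPrime ℓ ∧ ¬ W.HasMultiplicativeReductionAtPrime ℓ) →
          ψ (ℓ : ZMod f) ≠ 1 ∧ KrizLi2019.primVal (KrizLi2019.invMulOmega ψ ω) ℓ ≠ 1) ∧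
        KrizLi2019.IsKroneckerCharacterOf K εK ∧
        ‖KrizLi2019.bernoulliOnePrim (KrizLi2019.bernoulliCharOne ψ εK) *
            KrizLi2019.bernoulliOnePrim (KrizLi2019.bernoulliCharTwo ψ εK ω)‖ ≤ (p : ℝ)⁻¹ := by
  rw [not_exists_characterData_iff_forall_bernoulliFour_fails W p hCM hram h5]
  constructor
  · intro hall K _ _ hK hH hodd hd4
    obtain ⟨f₀, hf₀, ψ₀, ω₀, εK₀, hprim, hω₀, hss₀, h1, h1', h3, hεK₀⟩ :=
      exists_krizLiTriple_of_cmRamified W p hCM hram h5 K hK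
    exact ⟨f₀, hf₀, ψ₀, ω₀, εK₀, hprim, hω₀, hss₀, h1, h1', h3, hεK₀,
      hall K hK hH hodd hd4 f₀ ψ₀ ω₀ εK₀ hω₀ hss₀ hεK₀⟩
  · intro hall K _ _ hK hH hodd hd4 f _ ψ ω εK hω hss hεK
    obtain ⟨f₀, hf₀, ψ₀, ω₀, εK₀, -, hω₀, hss₀, -, -, -, hεK₀, hfail⟩ := hall K hK hH hodd hd4
    rw [bernoulliFour_iff_of_hss W h5 K ψ ψ₀ ω ω₀ εK εK₀ hω hω₀ hss hss₀ hεK hεK₀]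
    exact hfail

/-- **THE SPLIT: «NO CHARACTER DATA» ⟺ CLASS FACTOR NON-UNIT ∨ EVERY HEEGNER `K''`-FACTOR NON-UNIT.** Fix ANY odd character
datum `(f, ψ, ω)` of `W` with `hss` (e.g. the class character of `exists_krizLiTriple_odd_of_cmRamified`; on the rank-one window
`ψ` is always odd, w2 g4 census). Then `ψ₀⁻¹ε_K = ψ⁻¹` (w2 g4 `RegularLocusBernoulliPair.bernoulliOnePrim_bernoulliCharOne_of_not_even`,
p634386), both Bernoulli numbers are `p`-integral at a Heegner field (w3 g4 `BernoulliUnits.norm_bernoulliPair_le_one_of_hss`;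
`p ∤ d_{K''}` because `p ∣ N_W` splits), and the residue reads: «no character data» iff **`‖B_{1,ψ⁻¹}‖_p ≤ p⁻¹`** (the CLASS
invariant — the two level-`1` cells `17424bl1@11`, `305809c1@7` of the census) **or for every imaginary quadratic `K''` Heegner for
`N_W` with `d` odd `< −4` and its Kronecker character `ε_{K''}`: `‖B_{1,(ψε_{K''}ω⁻¹)~}‖_p ≤ p⁻¹`**.
[cite: KrizLi2019, Thm. 1.20 (p. 8), §7.1 (p. 43), Cor. 8.4] [cite: GrossLMS1991, §1 (p. 235)] -/
theorem not_exists_characterData_iff_classFactor_or_forall (hCM : W.HasCM) (hram : CMRamified W p) (h5 : 5 ≤ p)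
    {f : ℕ} [NeZero f] (ψ : DirichletCharacter ℚ_[p] f) (ω : DirichletCharacter ℚ_[p] p) (hψ : ψ.Odd)
    (hω : KrizLi2019.IsTeichmullerCharacter ω)
    (hss : ∀ ℓ : ℕ, ℓ.Prime → ¬ (ℓ ∣ p * W.conductorNorm ℤ) →
      ‖((W.LFunction ℓ : ℤ) : ℚ_[p]) - (ψ (ℓ : ZMod f) + ψ⁻¹ (ℓ : ZMod f) * ω (ℓ : ZMod p))‖ < 1) :
    (¬ ∃ (K : Type) (_ : Field K) (_ : NumberField K)
      (f : ℕ) (_ : NeZero f) (ψ : DirichletCharacter ℚ_[p] f) (ω : DirichletCharacter ℚ_[p] p)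
      (εK : DirichletCharacter ℚ_[p] (NumberField.discr K).natAbs),
      IsImaginaryQuadratic K ∧ SatisfiesHeegnerHypothesis (W.conductorNorm ℤ) K ∧ Odd (NumberField.discr K) ∧
      NumberField.discr K < -4 ∧ ψ.IsPrimitive ∧ KrizLi2019.IsTeichmullerCharacter ω ∧
      (∀ ℓ : ℕ, ℓ.Prime → ¬ (ℓ ∣ p * W.conductorNorm ℤ) →
        ‖((W.LFunction ℓ : ℤ) : ℚ_[p]) - (ψ (ℓ : ZMod f) + ψ⁻¹ (ℓ : ZMod f) * ω (ℓ : ZMod p))‖ < 1) ∧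
      ψ (p : ZMod f) ≠ 1 ∧ KrizLi2019.primVal (KrizLi2019.invMulOmega ψ ω) p ≠ 1 ∧
      (∀ ℓ : ℕ, (hℓ : ℓ.Prime) → ℓ ≠ p →
        (haveI := Fact.mk hℓ; ¬ W.HasGoodReductionAtPrime ℓ ∧ ¬ W.HasMultiplicativeReductionAtPrime ℓ) →
        ψ (ℓ : ZMod f) ≠ 1 ∧ KrizLi2019.primVal (KrizLi2019.invMulOmega ψ ω) ℓ ≠ 1) ∧
      KrizLi2019.IsKroneckerCharacterOf K εK ∧
      ¬ (‖KrizLi2019.bernoulliOnePrim (KrizLi2019.bernoulliCharOne ψ εK) *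
          KrizLi2019.bernoulliOnePrim (KrizLi2019.bernoulliCharTwo ψ εK ω)‖ ≤ (p : ℝ)⁻¹)) ↔
    (‖KrizLi2019.bernoulliOnePrim ψ⁻¹‖ ≤ (p : ℝ)⁻¹ ∨
      ∀ (K : Type) [Field K] [NumberField K], IsImaginaryQuadratic K → SatisfiesHeegnerHypothesis (W.conductorNorm ℤ) K →
        Odd (NumberField.discr K) → NumberField.discr K < -4 →
        ∀ εK : DirichletCharacter ℚ_[p] (NumberField.discr K).natAbs, KrizLi2019.IsKroneckerCharacterOf K εK →
          ‖KrizLi2019.bernoulliOnePrim (KrizLi2019.bernoulliCharTwo ψ εK ω)‖ ≤ (p : ℝ)⁻¹) := by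
  have hpp : p.Prime := Fact.out
  have hne : ¬ ψ.Even := EisensteinPair.not_even_of_odd' ψ hψ
  -- at a Heegner field of `N_W`, `p ∤ d_K` (the CM-ramified `p` divides `N_W`, hence splits in `K`)
  have hpd : ∀ (K : Type) [Field K] [NumberField K], IsImaginaryQuadratic K →
      SatisfiesHeegnerHypothesis (W.conductorNorm ℤ) K → ¬ p ∣ (NumberField.discr K).natAbs := by
    intro K _ _ hK hH
    rw [← Int.natCast_dvd]
    exact Literature.SatisfiesHeegnerHypothesis.not_dvd_discr hK.1 hH hpp
      (BorelTorsion.dvd_conductorNorm_of_cmRamified W p hCM hram)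
  rw [not_exists_characterData_iff_forall_bernoulliFour_fails W p hCM hram h5]
  constructor
  · intro hall
    by_cases hcls : ‖KrizLi2019.bernoulliOnePrim ψ⁻¹‖ ≤ (p : ℝ)⁻¹
    · exact Or.inl hcls
    · refine Or.inr fun K _ _ hK hH hodd hd4 εK hεK => ?_
      have hab := hall K hK hH hodd hd4 f ψ ω εK hω hss hεK
      obtain ⟨ha, hb⟩ := BernoulliUnits.norm_bernoulliPair_le_one_of_hss W hCM hram h5 hω ψ hss εK (hpd K hK hH)
      rw [RegularLocusBernoulliPair.bernoulliOnePrim_bernoulliCharOne_of_not_even ψ εK hne] at ha hab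
      have ha1 : ‖KrizLi2019.bernoulliOnePrim ψ⁻¹‖ = 1 := by
        by_contra hne1
        exact hcls (norm_le_inv_of_norm_lt_one (lt_of_le_of_ne ha hne1))
      rw [norm_mul, ha1, one_mul] at hab
      exact hab
  · intro hor K _ _ hK hH hodd hd4 f' _ ψ' ω' εK' hω' hss' hεK'
    -- move to the fixed odd datum `(ψ, ω)` at the same `ε_{K''}` by rigidity
    rw [bernoulliPair_eq_of_hss W h5 K ψ ψ' ω ω' εK' εK' hω hω' hss hss' hεK' hεK']
    obtain ⟨-, hb⟩ := BernoulliUnits.norm_bernoulliPair_le_one_of_hss W hCM hram h5 hω ψ hss εK' (hpd K hK hH)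
    rcases hor with hcls | hall
    · exact RegularLocusBernoulliPair.krizLi_bernoulli_hypothesis_fails_of_classFactor ψ εK' ω hne hcls hb
    · have hK2 := hall K hK hH hodd hd4 εK' hεK'
      obtain ⟨ha, -⟩ := BernoulliUnits.norm_bernoulliPair_le_one_of_hss W hCM hram h5 hω ψ hss εK' (hpd K hK hH)
      rw [norm_mul]
      have h0 : (0 : ℝ) ≤ (p : ℝ)⁻¹ := by positivity
      calc ‖KrizLi2019.bernoulliOnePrim (KrizLi2019.bernoulliCharOne ψ εK')‖ *
            ‖KrizLi2019.bernoulliOnePrim (KrizLi2019.bernoulliCharTwo ψ εK' ω)‖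
          ≤ 1 * (p : ℝ)⁻¹ := mul_le_mul ha hK2 (norm_nonneg _) zero_le_one
        _ = (p : ℝ)⁻¹ := one_mul _


/-- **(append, w3 g7, for registry v17's middle branch) UNIT CLASS FACTOR ∧ ONE ADMISSIBLE FIELD WITH UNIT `K''`-FACTOR ⟹ CHARACTER
DATA.** For `W` (CM, `CMRamified W p`, `5 ≤ p`) and any odd datum `(f, ψ, ω)` with `hss`: if `‖B_{1,ψ⁻¹}‖_p` is NOT `≤ p⁻¹` and some
imaginary quadratic `K''` Heegner for `N_W` with `d` odd `< −4` has a Kronecker character with `‖B_{1,(ψε_{K''}ω⁻¹)~}‖_p` NOT `≤ p⁻¹`,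
then the character data of v15/v16 EXIST (so the (KL) branch fires). Constructive reading of
`not_exists_characterData_iff_classFactor_or_forall`. [cite: KrizLi2019, Thm. 1.20 (p. 8), §7.1 (p. 43)] -/
theorem exists_characterData_of_unit_classFactor_of_unit_fieldFactor (hCM : W.HasCM) (hram : CMRamified W p) (h5 : 5 ≤ p)
    {f : ℕ} [NeZero f] (ψ : DirichletCharacter ℚ_[p] f) (ω : DirichletCharacter ℚ_[p] p) (hψ : ψ.Odd)
    (hω : KrizLi2019.IsTeichmullerCharacter ω)
    (hss : ∀ ℓ : ℕ, ℓ.Prime → ¬ (ℓ ∣ p * W.conductorNorm ℤ) →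
      ‖((W.LFunction ℓ : ℤ) : ℚ_[p]) - (ψ (ℓ : ZMod f) + ψ⁻¹ (ℓ : ZMod f) * ω (ℓ : ZMod p))‖ < 1)
    (hcls : ¬ ‖KrizLi2019.bernoulliOnePrim ψ⁻¹‖ ≤ (p : ℝ)⁻¹)
    (K : Type) [Field K] [NumberField K] (hK : IsImaginaryQuadratic K)
    (hH : SatisfiesHeegnerHypothesis (W.conductorNorm ℤ) K) (hodd : Odd (NumberField.discr K)) (hd4 : NumberField.discr K < -4)
    (εK : DirichletCharacter ℚ_[p] (NumberField.discr K).natAbs) (hεK : KrizLi2019.IsKroneckerCharacterOf K εK)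
    (hfld : ¬ ‖KrizLi2019.bernoulliOnePrim (KrizLi2019.bernoulliCharTwo ψ εK ω)‖ ≤ (p : ℝ)⁻¹) :
    ∃ (K : Type) (_ : Field K) (_ : NumberField K)
      (f : ℕ) (_ : NeZero f) (ψ : DirichletCharacter ℚ_[p] f) (ω : DirichletCharacter ℚ_[p] p)
      (εK : DirichletCharacter ℚ_[p] (NumberField.discr K).natAbs),
      IsImaginaryQuadratic K ∧ SatisfiesHeegnerHypothesis (W.conductorNorm ℤ) K ∧ Odd (NumberField.discr K) ∧
      NumberField.discr K < -4 ∧ ψ.IsPrimitive ∧ KrizLi2019.IsTeichmullerCharacter ω ∧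
      (∀ ℓ : ℕ, ℓ.Prime → ¬ (ℓ ∣ p * W.conductorNorm ℤ) →
        ‖((W.LFunction ℓ : ℤ) : ℚ_[p]) - (ψ (ℓ : ZMod f) + ψ⁻¹ (ℓ : ZMod f) * ω (ℓ : ZMod p))‖ < 1) ∧
      ψ (p : ZMod f) ≠ 1 ∧ KrizLi2019.primVal (KrizLi2019.invMulOmega ψ ω) p ≠ 1 ∧
      (∀ ℓ : ℕ, (hℓ : ℓ.Prime) → ℓ ≠ p →
        (haveI := Fact.mk hℓ; ¬ W.HasGoodReductionAtPrime ℓ ∧ ¬ W.HasMultiplicativeReductionAtPrime ℓ) →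
        ψ (ℓ : ZMod f) ≠ 1 ∧ KrizLi2019.primVal (KrizLi2019.invMulOmega ψ ω) ℓ ≠ 1) ∧
      KrizLi2019.IsKroneckerCharacterOf K εK ∧
      ¬ (‖KrizLi2019.bernoulliOnePrim (KrizLi2019.bernoulliCharOne ψ εK) *
          KrizLi2019.bernoulliOnePrim (KrizLi2019.bernoulliCharTwo ψ εK ω)‖ ≤ (p : ℝ)⁻¹) := by
  by_contra hne
  rcases (not_exists_characterData_iff_classFactor_or_forall W p hCM hram h5 ψ ω hψ hω hss).mp hne with h | h
  · exact hcls h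
  · exact hfld (h K hK hH hodd hd4 εK hεK)

/-- **(append) … and conversely «NO CHARACTER DATA» hands v17's two residual branches their hypotheses**: either the CLASS factor
is a non-unit (B1 `stub_bsdp_of_classFactor`'s hypothesis) or every admissible `K''`-factor is (B2′ `stub_bsdp_of_noAdmissibleField`'s).
The `.mp` direction of `not_exists_characterData_iff_classFactor_or_forall`, displayed for the composition. [cite: KrizLi2019, Thm. 1.20 (p. 8), §7.1 (p. 43)] -/
theorem classFactor_or_forall_fieldFactor_of_not_exists_characterData (hCM : W.HasCM) (hram : CMRamified W p) (h5 : 5 ≤ p)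
    {f : ℕ} [NeZero f] (ψ : DirichletCharacter ℚ_[p] f) (ω : DirichletCharacter ℚ_[p] p) (hψ : ψ.Odd)
    (hω : KrizLi2019.IsTeichmullerCharacter ω)
    (hss : ∀ ℓ : ℕ, ℓ.Prime → ¬ (ℓ ∣ p * W.conductorNorm ℤ) →
      ‖((W.LFunction ℓ : ℤ) : ℚ_[p]) - (ψ (ℓ : ZMod f) + ψ⁻¹ (ℓ : ZMod f) * ω (ℓ : ZMod p))‖ < 1)
    (hno : ¬ ∃ (K : Type) (_ : Field K) (_ : NumberField K)
      (f : ℕ) (_ : NeZero f) (ψ : DirichletCharacter ℚ_[p] f) (ω : DirichletCharacter ℚ_[p] p)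
      (εK : DirichletCharacter ℚ_[p] (NumberField.discr K).natAbs),
      IsImaginaryQuadratic K ∧ SatisfiesHeegnerHypothesis (W.conductorNorm ℤ) K ∧ Odd (NumberField.discr K) ∧
      NumberField.discr K < -4 ∧ ψ.IsPrimitive ∧ KrizLi2019.IsTeichmullerCharacter ω ∧
      (∀ ℓ : ℕ, ℓ.Prime → ¬ (ℓ ∣ p * W.conductorNorm ℤ) →
        ‖((W.LFunction ℓ : ℤ) : ℚ_[p]) - (ψ (ℓ : ZMod f) + ψ⁻¹ (ℓ : ZMod f) * ω (ℓ : ZMod p))‖ < 1) ∧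
      ψ (p : ZMod f) ≠ 1 ∧ KrizLi2019.primVal (KrizLi2019.invMulOmega ψ ω) p ≠ 1 ∧
      (∀ ℓ : ℕ, (hℓ : ℓ.Prime) → ℓ ≠ p →
        (haveI := Fact.mk hℓ; ¬ W.HasGoodReductionAtPrime ℓ ∧ ¬ W.HasMultiplicativeReductionAtPrime ℓ) →
        ψ (ℓ : ZMod f) ≠ 1 ∧ KrizLi2019.primVal (KrizLi2019.invMulOmega ψ ω) ℓ ≠ 1) ∧
      KrizLi2019.IsKroneckerCharacterOf K εK ∧
      ¬ (‖KrizLi2019.bernoulliOnePrim (KrizLi2019.bernoulliCharOne ψ εK) *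
          KrizLi2019.bernoulliOnePrim (KrizLi2019.bernoulliCharTwo ψ εK ω)‖ ≤ (p : ℝ)⁻¹)) :
    ‖KrizLi2019.bernoulliOnePrim ψ⁻¹‖ ≤ (p : ℝ)⁻¹ ∨
      ∀ (K : Type) [Field K] [NumberField K], IsImaginaryQuadratic K → SatisfiesHeegnerHypothesis (W.conductorNorm ℤ) K →
        Odd (NumberField.discr K) → NumberField.discr K < -4 →
        ∀ εK : DirichletCharacter ℚ_[p] (NumberField.discr K).natAbs, KrizLi2019.IsKroneckerCharacterOf K εK →
          ‖KrizLi2019.bernoulliOnePrim (KrizLi2019.bernoulliCharTwo ψ εK ω)‖ ≤ (p : ℝ)⁻¹ :=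
  (not_exists_characterData_iff_classFactor_or_forall W p hCM hram h5 ψ ω hψ hω hss).mp hno

end Residue

end Summit.BirchSwinnertonDyer.BirchSwinnertonDyer.Theorems.PrintCFram.OffLocusResidue

end
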